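import Summits.QuantumFields.YangMills.Theorems.BalabanUVNodesN15KingModelSlicesTwoSpacingDatum
import HarnessLib

/-!
# BalabanUVNodes ∕ N15 — THE KING-MODEL RUNG, CURVED EDITION (PART Χ-a₂): THE BRIDGES FROM THE TWO-SPACING DATUM `kingSlicesTwoSpacing` (part Χ-a)
# TO PARTS F∕H∕M — the data's slice kernels `G^η_{(j)}`, `G^{η′}_{(j+n)}` and their gradients, `1 ≤ j < k`, ARE `(L^jη)^{2−D}·ksSlice`,
# `(L^jη)^{2−D}·ksSlice′`, `(L^jη)^{1−D}·ksDSlice`, `(L^jη)^{1−D}·ksDSlice′` at the two-spacing index `kingSliceIdx₂ = (k + e_M − j − 1, j, n)`, and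
# King's pairing IS part C's `underPtN` there (Track A, DAG node N15 = NE2; FAN-OUT v1.1 §N15 s3 «KING-MODEL RUNG»)

HONEST FRAMING.  Count-neutral (cell `pub-ymgap`, seat `pub-ymgap-dag-n15-e` g18; `--supports stmt-QuantumFields-27366 --as helper` = K3⁸
`SpineGivenEndpointR13SepCoPHV`).  TEMPLATE LITERATURE, `A = 0`: C. King's scalar U(1)-Higgs MODEL on finite tori ([King1986] (2.17) p. 653, (2.20) p. 654,
p. 664 (pairing), (4.42) p. 675); NOT Bałaban's covariant objects; NE2⁺ is NOT PRINTED for those and not proved; NOT a node discharge; nothing continuum ∕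
ℝ⁴ ∕ OS ∕ mass-gap ∕ Clay.  0 `sorry`; ONE plumbing `def` (the two-spacing slice index `kingSliceIdx₂`, reducible) — definition lane; standard axioms.
CONTENT: `kingSliceIdx₂` + its two carrier identities (`_carrier_lo`: `L^k·2L^{e_M} = L^j·(L·2L^{k+e_M−j−1})`; `_carrier_hi`: `L^{k+n}·2L^{e_M} =
L^nL^j·(L·2L^{k+e_M−j−1})`); ★ `kingSlicePt_bridge`; `pow_div_pow_shift`, `sliceRatio_rpow_key`; ★ `kingSliceG_lo_eq`, ★ `kingSliceG_hi_eq` (the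
`(k+n)`-run's slice `j + n` IS part F's fine piece `ksSlice′` at the two-spacing index — Χ-a `ksSlice'_eq_ksSlice` + `ksSlice_reindex`), ★ `kingSliceDG_lo_eq`,
★ `kingSliceDG_hi_eq`.  These are exactly the identities through which part Χ-b reads part M `ksSlice_rate_unif` ∕ part M′ `ksDSlice_rate_unif`.
HONEST SCOPE as in part Χ-a (the (2.20)∕(2.17) dictionary APPLIED as the definition of the level-`k` kernels).
Locators: [King1986] (2.17) p.653, (2.20) p.654, Prop. 3.7 p.663 («Furthermore»), p.664 (pairing), Prop. 3.9 (3.73) p.665, (4.42) p.675.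
-/

noncomputable section

namespace Summit.QuantumFields.YangMills.BalabanUVNodes.N15KingModelRung.Curved

open Real Finset Matrix
open Literature.MathematicalPhysics.QuantumFieldTheory.Balaban1983to89.B5Prop11Plancherel (Tor fine unitVec)
open Literature.MathematicalPhysics.QuantumFieldTheory.King1986 (aK)
open Literature.MathematicalPhysics.QuantumFieldTheory.King1986.Torus (blockOf tdistT tdistT_nonneg torCongr torCongr_add torCongr_unitVec
  tdistT_torCongr val_torCongr torCongr_refl)
open Literature.MathematicalPhysics.QuantumFieldTheory.King1986.SlicePropagator (SliceKernels TwoSpacing holderDeriv)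

variable {d : ℕ} (L : ℕ) [NeZero L]

/-! ## §4 The bridges to parts F∕H∕M: the data's slices at the two-spacing index -/

section Bridges

/-- THE TWO-SPACING INDEX of slice `1 ≤ j < k` with `n` extra steps (`e := k + e_M − j − 1`, physical volume exponent `0`, size letter `1`) — the index at which
part M's `ksSlice_rate_unif` ∕ part M′'s `ksDSlice_rate_unif` are read. [cite: King1986, (2.17) p.653, p.664 (two spacings)] -/
abbrev kingSliceIdx₂ (k eM j n : ℕ) (hj : 1 ≤ j) (hn : 1 ≤ n) : KSliceIdx d := ⟨k + eM - j - 1, j, hj, n, hn, 0, Nat.zero_le _, 1, le_rfl⟩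

variable {L} {k n eM : ℕ} (M : Fin (d + 1) → ℕ) [∀ μ, NeZero (M μ)]

omit [NeZero L] [∀ μ, NeZero (M μ)] in
/-- The coarse carrier identity at the two-spacing index: `L^k·2L^{e_M} = L^j·(L·2L^{k+e_M−j−1})`. [cite: King1986, (2.20) p.654] -/
theorem kingSliceIdx₂_carrier_lo (hM : ∀ μ, M μ = 2 * L ^ eM) {j : ℕ} (hj : 1 ≤ j) (hjk : j < k) (hn : 1 ≤ n) :
    ∀ μ, fine (L ^ k) M μ = fine (L ^ (kingSliceIdx₂ (d := d) k eM j n hj hn).j) (ksU L (kingSliceIdx₂ k eM j n hj hn)) μ :=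
  sliceCarrier_eq L (kingSliceIdx₂ k eM j n hj hn) M hM (by show j + (k + eM - j - 1) + 1 = k + eM; omega)

omit [NeZero L] [∀ μ, NeZero (M μ)] in
/-- The fine carrier identity at the two-spacing index: `L^{k+n}·2L^{e_M} = L^nL^j·(L·2L^{k+e_M−j−1})`. [cite: King1986, (2.20) p.654] -/
theorem kingSliceIdx₂_carrier_hi (hM : ∀ μ, M μ = 2 * L ^ eM) {j : ℕ} (hj : 1 ≤ j) (hjk : j < k) (hn : 1 ≤ n) :
    ∀ μ, fine (L ^ (k + n)) M μ
      = fine (L ^ (kingSliceIdx₂ (d := d) k eM j n hj hn).n * L ^ (kingSliceIdx₂ (d := d) k eM j n hj hn).j)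
          (ksU L (kingSliceIdx₂ k eM j n hj hn)) μ := by
  intro μ
  show L ^ (k + n) * M μ = L ^ n * L ^ j * (L * (2 * L ^ (k + eM - j - 1)))
  rw [hM μ]
  have hk : k + n + eM = n + (j + ((k + eM - j - 1) + 1)) := by omega
  calc L ^ (k + n) * (2 * L ^ eM) = 2 * L ^ (k + n + eM) := by rw [pow_add L (k + n) eM]; ring
    _ = 2 * L ^ (n + (j + ((k + eM - j - 1) + 1))) := by rw [hk]
    _ = L ^ n * L ^ j * (L * (2 * L ^ (k + eM - j - 1))) := by rw [pow_add, pow_add, pow_succ]; ring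

/-- ★ **THE PAIRING IS PART C's `underPtN` ON THE TWO-SPACING CARRIERS** (both are `x_μ = ⌊x′_μ∕L^n⌋` on representatives). [cite: King1986, p.664 (pairing)] -/
theorem kingSlicePt_bridge (hM : ∀ μ, M μ = 2 * L ^ eM) {j : ℕ} (hj : 1 ≤ j) (hjk : j < k) (hn : 1 ≤ n) (x' : Tor (fine (L ^ (k + n)) M)) :
    torCongr (kingSliceIdx₂_carrier_lo M hM hj hjk hn) (kingSlicePt L k n M x')
      = underPtN L j n (ksU L (kingSliceIdx₂ k eM j n hj hn)) (torCongr (kingSliceIdx₂_carrier_hi M hM hj hjk hn) x') := by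
  funext μ
  apply ZMod.val_injective
  rw [val_torCongr, val_kingSlicePt, val_underPtN, val_torCongr]

omit [∀ μ, NeZero (M μ)] in
/-- The ratio of slice lengths does not see the common shift: `L^{j+n}∕L^{k+n} = L^j∕L^k`. [folklore] -/
theorem pow_div_pow_shift (j k n : ℕ) : (L : ℝ) ^ (j + n) / (L : ℝ) ^ (k + n) = (L : ℝ) ^ j / (L : ℝ) ^ k := by
  have hL0 : (0 : ℝ) < L := by exact_mod_cast Nat.pos_of_ne_zero (NeZero.ne L)
  rw [div_eq_div_iff (pow_pos hL0 _).ne' (pow_pos hL0 _).ne']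
  ring

/-- ★ **THE COARSE SLICE AT THE TWO-SPACING INDEX**: for `1 ≤ j < k`, `G^η_{(j)}(x, y) = (L^j∕L^k)^{2−D}·ksSlice_{(k+e_M−j−1, j, n)}(x, y)` at the mass
`m²(L^j∕L^k)²` (part Ρ-e's definition re-read at the index with `n` extra steps — parts F∕H's pieces do not read `n`). [cite: King1986, (2.17) p.653, (2.20) p.654, (4.42) p.675] -/
theorem kingSliceG_lo_eq (hM : ∀ μ, M μ = 2 * L ^ eM) (hk : 1 ≤ k) (a msq : ℝ) {j : ℕ} (hj : 1 ≤ j) (hjk : j < k) (hn : 1 ≤ n) (x y : Tor (fine (L ^ k) M)) :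
    kingSliceG L k eM M hM hk a msq j x y
      = ((L : ℝ) ^ j / (L : ℝ) ^ k) ^ ((2 : ℝ) - (d + 1 : ℕ)) *
          ksSlice L a (msq * ((L : ℝ) ^ j / (L : ℝ) ^ k) ^ 2) (kingSliceIdx₂ k eM j n hj hn)
            (torCongr (kingSliceIdx₂_carrier_lo M hM hj hjk hn) x) (torCongr (kingSliceIdx₂_carrier_lo M hM hj hjk hn) y) := by
  rw [kingSliceG_of_pos M hM hk a msq hj hjk,
    ← ksSlice_reindex L a _ (i₁ := kingSliceIdx k eM j hj) (i₂ := kingSliceIdx₂ k eM j n hj hn) rfl rfl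
      (fun μ => ((kingSliceIdx_carrier L M hM hj hjk) μ).symm.trans ((kingSliceIdx₂_carrier_lo M hM hj hjk hn) μ)),
    torCongr_torCongr, torCongr_torCongr]

/-- ★ **THE FINE SLICE AT THE TWO-SPACING INDEX**: for `1 ≤ j < k`, `G^{η′}_{(j+n)}(x′, y′) = (L^j∕L^k)^{2−D}·ksSlice′_{(k+e_M−j−1, j, n)}(x′, y′)` at the SAME
mass `m²(L^j∕L^k)²` — the `(k+n)`-run's slice `j + n` (part Ρ-e, index `(k+n+e_M−(j+n)−1, j+n)`) IS part F's fine piece at the two-spacing index (§1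
`ksSlice'_eq_ksSlice` + `ksSlice_reindex`). [cite: King1986, (2.17) p.653, (2.20) p.654, Prop. 3.7 p.663 («Furthermore»), (4.42) p.675] -/
theorem kingSliceG_hi_eq (hM : ∀ μ, M μ = 2 * L ^ eM) (hk : 1 ≤ k) (a msq : ℝ) {j : ℕ} (hj : 1 ≤ j) (hjk : j < k) (hn : 1 ≤ n) (x' y' : Tor (fine (L ^ (k + n)) M)) :
    kingSliceG L (k + n) eM M hM (one_le_add_of_one_le hk n) a msq (j + n) x' y'
      = ((L : ℝ) ^ j / (L : ℝ) ^ k) ^ ((2 : ℝ) - (d + 1 : ℕ)) *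
          ksSlice' L a (msq * ((L : ℝ) ^ j / (L : ℝ) ^ k) ^ 2) (kingSliceIdx₂ k eM j n hj hn)
            (torCongr (kingSliceIdx₂_carrier_hi M hM hj hjk hn) x') (torCongr (kingSliceIdx₂_carrier_hi M hM hj hjk hn) y') := by
  have hj' : 1 ≤ j + n := by omega
  have hjk' : j + n < k + n := by omega
  rw [kingSliceG_of_pos M hM (one_le_add_of_one_le hk n) a msq hj' hjk', pow_div_pow_shift,
    ← ksSlice'_eq_ksSlice L a _ (i := kingSliceIdx₂ k eM j n hj hn) (i₂ := kingSliceIdx (k + n) eM (j + n) hj')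
      (by show k + eM - j - 1 = k + n + eM - (j + n) - 1; omega) rfl
      (fun μ => ((kingSliceIdx₂_carrier_hi M hM hj hjk hn) μ).symm.trans ((kingSliceIdx_carrier L M hM hj' hjk') μ)),
    torCongr_torCongr, torCongr_torCongr]

/-- The unit-conversion identity behind the gradient bridges: `(L^j∕L^k)^{2−D}·L^k = (L^j∕L^k)^{1−D}·L^j`. [folklore] -/
theorem sliceRatio_rpow_key (j k : ℕ) :
    ((L : ℝ) ^ j / (L : ℝ) ^ k) ^ ((2 : ℝ) - (d + 1 : ℕ)) * (L : ℝ) ^ k = ((L : ℝ) ^ j / (L : ℝ) ^ k) ^ ((1 : ℝ) - (d + 1 : ℕ)) * (L : ℝ) ^ j := by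
  have hL0 : (0 : ℝ) < L := by exact_mod_cast Nat.pos_of_ne_zero (NeZero.ne L)
  have hk : (0 : ℝ) < (L : ℝ) ^ k := pow_pos hL0 _
  have hs0 : 0 < (L : ℝ) ^ j / (L : ℝ) ^ k := div_pos (pow_pos hL0 _) hk
  have h1 : ((L : ℝ) ^ j / (L : ℝ) ^ k) ^ ((2 : ℝ) - (d + 1 : ℕ))
      = ((L : ℝ) ^ j / (L : ℝ) ^ k) ^ ((1 : ℝ) - (d + 1 : ℕ)) * ((L : ℝ) ^ j / (L : ℝ) ^ k) := by
    rw [rpow_mul_self_eq hs0]; congr 1; ring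
  rw [h1, mul_assoc, div_mul_cancel₀ _ hk.ne']

/-- ★ **THE COARSE GRADIENT SLICE AT THE TWO-SPACING INDEX**: for `1 ≤ j < k`, `∂^η_μG^η_{(j)}(x, y) = (L^j∕L^k)^{1−D}·ksDSlice_{(k+e_M−j−1, j, n),μ}(x, y)`
(part K `ksDSlice_eq_fwdDiff`: part H's piece is the scale-`j` forward difference of part F's; `L^k∕L^j = (L^jη)^{−1}`). [cite: King1986, (2.17) p.653, Prop. 3.9 (3.73) p.665 (second line), (4.42) p.675] -/
theorem kingSliceDG_lo_eq (hM : ∀ μ, M μ = 2 * L ^ eM) (hk : 1 ≤ k) (a msq : ℝ) {j : ℕ} (hj : 1 ≤ j) (hjk : j < k) (hn : 1 ≤ n)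
    (μ : Fin (d + 1)) (x y : Tor (fine (L ^ k) M)) :
    (kingSliceKernels L k eM M hM hk a msq).dG j μ x y
      = ((L : ℝ) ^ j / (L : ℝ) ^ k) ^ ((1 : ℝ) - (d + 1 : ℕ)) *
          ksDSlice L a (msq * ((L : ℝ) ^ j / (L : ℝ) ^ k) ^ 2) (kingSliceIdx₂ k eM j n hj hn) μ
            (torCongr (kingSliceIdx₂_carrier_lo M hM hj hjk hn) x) (torCongr (kingSliceIdx₂_carrier_lo M hM hj hjk hn) y) := by
  rw [kingSliceKernels_dG, kingSliceG_lo_eq M hM hk a msq hj hjk hn, kingSliceG_lo_eq M hM hk a msq hj hjk hn, torCongr_add,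
    torCongr_unitVec, ksDSlice_eq_fwdDiff, ← mul_sub, ← mul_assoc, mul_comm ((L : ℝ) ^ k), sliceRatio_rpow_key, mul_assoc]
  push_cast
  rfl

/-- ★ **THE FINE GRADIENT SLICE AT THE TWO-SPACING INDEX**: for `1 ≤ j < k`, `∂^{η′}_μG^{η′}_{(j+n)}(x′, y′) = (L^j∕L^k)^{1−D}·ksDSlice′_{(k+e_M−j−1, j, n),μ}(x′, y′)`
(part O-b′ `ksDSlice'_eq_fwdDiff`; `L^{k+n}∕(L^nL^j) = (L^jη)^{−1}`). [cite: King1986, (2.17) p.653, Prop. 3.9 (3.73) p.665 (second line), (4.42) p.675] -/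
theorem kingSliceDG_hi_eq (hM : ∀ μ, M μ = 2 * L ^ eM) (hk : 1 ≤ k) (a msq : ℝ) {j : ℕ} (hj : 1 ≤ j) (hjk : j < k) (hn : 1 ≤ n)
    (μ : Fin (d + 1)) (x' y' : Tor (fine (L ^ (k + n)) M)) :
    (kingSlicesTwoSpacing L k n eM M hM hk a msq).hi.dG j μ x' y'
      = ((L : ℝ) ^ j / (L : ℝ) ^ k) ^ ((1 : ℝ) - (d + 1 : ℕ)) *
          ksDSlice' L a (msq * ((L : ℝ) ^ j / (L : ℝ) ^ k) ^ 2) (kingSliceIdx₂ k eM j n hj hn) μ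
            (torCongr (kingSliceIdx₂_carrier_hi M hM hj hjk hn) x') (torCongr (kingSliceIdx₂_carrier_hi M hM hj hjk hn) y') := by
  rw [kingSlicesTwoSpacing_hidG, kingSliceG_hi_eq M hM hk a msq hj hjk hn, kingSliceG_hi_eq M hM hk a msq hj hjk hn, torCongr_add,
    torCongr_unitVec, ksDSlice'_eq_fwdDiff, ← mul_sub, ← mul_assoc]
  have key := sliceRatio_rpow_key (d := d) (L := L) j k
  have hkey : (L : ℝ) ^ (k + n) * ((L : ℝ) ^ j / (L : ℝ) ^ k) ^ ((2 : ℝ) - (d + 1 : ℕ))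
      = ((L : ℝ) ^ j / (L : ℝ) ^ k) ^ ((1 : ℝ) - (d + 1 : ℕ)) * ((L : ℝ) ^ n * (L : ℝ) ^ j) := by
    rw [pow_add]; linear_combination (L : ℝ) ^ n * key
  rw [hkey, mul_assoc]
  push_cast
  rfl

end Bridges

end Summit.QuantumFields.YangMills.BalabanUVNodes.N15KingModelRung.Curved

end
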